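import Summits.HodgeConjecture.HodgeConjecture.Theorems.H413SpectrumJunction
import Literature.NumberTheory.Automorphic.AutomorphicFormsL2OrbitalSmoothing
import Mathlib.Analysis.Calculus.MeanValue
import Mathlib.Topology.Algebra.Module.FiniteDimension
import HarnessLib

/-!
# Crux `HLiu418` — K-LANE SUB-LINE F0-P5TP2SpectralProjection, STUB (S₂) — part 1 (generic): the `𝔭`-orbit map of the `L²`
# class of a regular automorphic function along a ONE-PARAMETER PROBE FAMILY, and the `L²` image of a reproducing kernel

HC_CM is proved only modulo the printed citations until rung 0 closes.  Cell `hodgecm-mathlib`, floor 0, programme P5, named fact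
TP₂ = ★ `UnitaryCurveForms.holCotFormSpectralProjection₂`, sub-line skeleton `Cruxes/HLiu418/Lines/F0_P5TP2SpectralProjection.lean`
(A-p14 (g16), v1 d60641ce), stub (S₂) `stub_S₂ : StubS₂CotFormL2Data`; this is the GENERIC half (any adelic group datum `𝒢`, any
topological group `S` with a continuous `ιinf : S →* G(𝔸_K)`, any continuous probe family `γ : ℂ → S` with the RAY LAW
`γ((s+t)z) = γ(sz) γ(tz)`, `s t : ℝ` — e.g. `γ z = exp (X z)` for an `ℝ`-linear `X`), consumed by `Theorems/F0P5TP2StubS2.lean` (the CM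
assembly at rank 2).  It is the rank-free, FIRST-ORDER replacement of the rank-3 ★ `Theorems/F0P2dStubSOrbitMap` (which used the
`U(2,1)` Lie-derivative layer and a second-order Taylor bound).  THEOREMS ONLY; no definition, no instance, no `sorry`.

* §1 `hasDerivAt_ray`, `norm_sub_sub_le_of_ray` — along the ray `t ↦ x ιinf γ(tz)` the function `Φ` has derivative `D_{x ιinf γ(sz)} z`
  (`D_y := fderiv ℝ (w ↦ Φ(y ιinf γ w)) 0`, ray law), so by the mean value inequality
  `‖Φ(x ιinf γ z) − Φ x − D_x z‖ ≤ ε ‖z‖` as soon as `‖D_{x ιinf γ(sz)} − D_x‖ ≤ ε` on `s ∈ [0,1]`.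
* §2 `exists_forall_norm_fderiv_sub_lt` — on a COMPACT automorphic quotient, for `Φ` left-invariant with `y ↦ D_y z` continuous,
  `‖D_{x ιinf γ(w)} − D_x‖ < ε` for ALL `x` once `‖w‖ < δ` (the continuous, left-invariant `(x,w) ↦ D_{x ιinf γ w} − D_x` descends along
  the open quotient map `mk × id` and vanishes on the compact slice `w = 0`: tube lemma).
* §3 `exists_hasFDerivAt_rightRegular_toLp` — the orbit map `z ↦ R(ιinf γ z)[Φ]` has a Fréchet derivative `D` at `0` with
  `D z = [y ↦ D_y z]` (remainder of `L²`-norm `≤ μ(X)^{1/2} ε ‖z‖`, Mathlib `Lp.norm_le_of_ae_bound`);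
  `differentiableAt_rightRegular_toLp_of_probeCR` — hence `diffOrbit`, and weak Cauchy–Riemann from pointwise Cauchy–Riemann.
* §4 `integral_smul_rightRegular_toLp_eq_self` — pointwise reproduction `∫ A(u) Φ(y ιA u) dν = Φ(y)` by a continuous compactly
  supported scalar kernel gives `∫ A(u) • R(ιA u)[Φ] dν = [Φ]` in `L²(μ)` (Fubini representative ★ p796993
  `coeFn_integral_smul_rightRegular_toLp_eq_orbitalIntegral`).
* §5 `rightRegular_toLp_toQuotFun_eq_smul` ∕ `_eq_self'` — pointwise `Φ(x a) = c Φ(x)` gives `R(a)[Φ] = c • [Φ]`.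
## References
* [Borel1997] A. Borel, *Automorphic forms on SL₂(ℝ)*, Cambridge Tracts in Math. 130 (1997), §2.1 (4), Thm. 2.13, §5.14.
* [BorelJacquet1979] A. Borel, H. Jacquet, *Automorphic forms and automorphic representations*, PSPM 33.1 (1979), §4.2, §4.6.
* [BorelWallach2000] A. Borel, N. Wallach, *Continuous cohomology, discrete subgroups, and representations…*, 2nd ed., VII 2.10.
-/

set_option autoImplicit false
set_option linter.dupNamespace false -- the mandated namespace repeats `HodgeConjecture.HodgeConjecture`

noncomputable section

namespace Summit.HodgeConjecture.HodgeConjecture.Cruxes.HLiu418.F0P5TP2StubS2OrbitMap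

open MeasureTheory NumberField Filter Topology Asymptotics Set
open scoped ENNReal NNReal
open Literature.NumberTheory.Automorphic
open Literature.NumberTheory.Automorphic.UnitaryGroup.CotangentForms (toQuotFun toQuotFun_mk)
open Summit.HodgeConjecture.HodgeConjecture.Cruxes.H413.SpectrumJunction

/-! ## §1 Ray calculus: a probe family with the ray law `γ((s+t)z) = γ(sz) γ(tz)` -/

section Ray

variable {G : Type*} [Group G] {S : Type*} [Group S] (ιinf : S →* G) (γ : ℂ → S)
  (hγadd : ∀ (s t : ℝ) (z : ℂ), γ (((s + t : ℝ) : ℂ) * z) = γ (((s : ℝ) : ℂ) * z) * γ (((t : ℝ) : ℂ) * z))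

include hγadd in
/-- **Derivative along a ray.**  If every probe `w ↦ Φ (y · ιinf (γ w))` is differentiable at `0`, then for fixed `x`, `z` the ray
function `t ↦ Φ (x · ιinf (γ (t z)))` has derivative `D_{x ιinf γ(sz)} z` at every `s : ℝ` (ray law: `γ((s+h)z) = γ(sz) γ(hz)`, so near `s`
the ray function is the probe at the base point `x ιinf γ(sz)`). [cite: Borel1997, §2.1 (4)] -/
theorem hasDerivAt_ray {Φ : G → ℂ} (hdiff : ∀ y, DifferentiableAt ℝ (fun w : ℂ => Φ (y * ιinf (γ w))) 0)
    (x : G) (z : ℂ) (s : ℝ) :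
    HasDerivAt (fun t : ℝ => Φ (x * ιinf (γ (((t : ℝ) : ℂ) * z))))
      (fderiv ℝ (fun w : ℂ => Φ (x * ιinf (γ (((s : ℝ) : ℂ) * z)) * ιinf (γ w))) 0 z) s := by
  set y : G := x * ιinf (γ (((s : ℝ) : ℂ) * z)) with hy
  have e : (fun t : ℝ => Φ (x * ιinf (γ (((t : ℝ) : ℂ) * z)))) =
      (fun w : ℂ => Φ (y * ιinf (γ w))) ∘ fun t : ℝ => (((t - s : ℝ)) : ℂ) * z := by
    funext t
    have h := hγadd s (t - s) z
    have e1 : ((s + (t - s) : ℝ) : ℂ) = ((t : ℝ) : ℂ) := by push_cast; ring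
    rw [e1] at h
    simp only [Function.comp_apply, hy, h, map_mul, mul_assoc]
  rw [e]
  have hin : HasDerivAt (fun t : ℝ => (((t - s : ℝ)) : ℂ) * z) z s := by
    have h1 : HasDerivAt (fun t : ℝ => (((t - s : ℝ)) : ℂ)) 1 s := by
      have h0 := ((hasDerivAt_id s).sub_const s).ofReal_comp
      simpa using h0
    simpa using h1.mul_const z
  have hout : HasFDerivAt (fun w : ℂ => Φ (y * ιinf (γ w)))
      (fderiv ℝ (fun w : ℂ => Φ (y * ιinf (γ w))) 0) ((fun t : ℝ => (((t - s : ℝ)) : ℂ) * z) s) := by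
    have h0 : (fun t : ℝ => (((t - s : ℝ)) : ℂ) * z) s = 0 := by simp
    rw [h0]
    exact (hdiff y).hasFDerivAt
  exact hout.comp_hasDerivAt s hin

include hγadd in
/-- **First-order remainder along a ray (mean value).**  If along the segment `s ∈ [0,1]` the probe differentials at the base
points `x ιinf γ(sz)` stay `ε`-close (operator norm) to the one at `x`, then
`‖Φ(x ιinf γ z) − Φ(x) − D_x z‖ ≤ ε ‖z‖` (Mathlib `norm_image_sub_le_of_norm_deriv_le_segment'` applied to
`t ↦ Φ(x ιinf γ(tz)) − t D_x z`). [cite: Borel1997, §2.1 (4)] -/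
theorem norm_sub_sub_le_of_ray {Φ : G → ℂ} (hdiff : ∀ y, DifferentiableAt ℝ (fun w : ℂ => Φ (y * ιinf (γ w))) 0)
    (hγ0 : γ 0 = 1) (x : G) (z : ℂ) {ε : ℝ}
    (hε : ∀ s : ℝ, s ∈ Icc (0 : ℝ) 1 →
      ‖fderiv ℝ (fun w : ℂ => Φ (x * ιinf (γ (((s : ℝ) : ℂ) * z)) * ιinf (γ w))) 0 -
        fderiv ℝ (fun w : ℂ => Φ (x * ιinf (γ w))) 0‖ ≤ ε) :
    ‖Φ (x * ιinf (γ z)) - Φ x - fderiv ℝ (fun w : ℂ => Φ (x * ιinf (γ w))) 0 z‖ ≤ ε * ‖z‖ := by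
  set D : ℂ →L[ℝ] ℂ := fderiv ℝ (fun w : ℂ => Φ (x * ιinf (γ w))) 0 with hD
  set θ : ℝ → ℂ := fun t => Φ (x * ιinf (γ (((t : ℝ) : ℂ) * z))) - ((t : ℝ) : ℂ) * D z with hθ
  have hderiv : ∀ t : ℝ, HasDerivAt θ
      (fderiv ℝ (fun w : ℂ => Φ (x * ιinf (γ (((t : ℝ) : ℂ) * z)) * ιinf (γ w))) 0 z - D z) t := by
    intro t
    have h1 := hasDerivAt_ray ιinf γ hγadd hdiff x z t
    have h2 : HasDerivAt (fun t : ℝ => ((t : ℝ) : ℂ) * D z) (D z) t := by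
      simpa using ((hasDerivAt_id t).ofReal_comp).mul_const (D z)
    exact h1.sub h2
  have hbound : ∀ t ∈ Ico (0 : ℝ) 1,
      ‖fderiv ℝ (fun w : ℂ => Φ (x * ιinf (γ (((t : ℝ) : ℂ) * z)) * ιinf (γ w))) 0 z - D z‖ ≤ ε * ‖z‖ := by
    intro t ht
    rw [show fderiv ℝ (fun w : ℂ => Φ (x * ιinf (γ (((t : ℝ) : ℂ) * z)) * ιinf (γ w))) 0 z - D z =
      (fderiv ℝ (fun w : ℂ => Φ (x * ιinf (γ (((t : ℝ) : ℂ) * z)) * ιinf (γ w))) 0 - D) z from rfl]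
    exact (ContinuousLinearMap.le_opNorm _ _).trans
      (mul_le_mul_of_nonneg_right (hε t (Ico_subset_Icc_self ht)) (norm_nonneg _))
  have h := norm_image_sub_le_of_norm_deriv_le_segment' (fun t _ => (hderiv t).hasDerivWithinAt) hbound 1
    (right_mem_Icc.2 zero_le_one)
  have e1 : θ 1 = Φ (x * ιinf (γ z)) - D z := by simp [hθ]
  have e0 : θ 0 = Φ x := by simp [hθ, hγ0]
  rw [e1, e0, sub_zero, mul_one] at h
  simpa [sub_right_comm] using h

end Ray

/-! ## §2 Uniform smallness of the probe differential along short translates, on a compact automorphic quotient -/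

section Uniform

variable {K : Type} [Field K] [NumberField K] {𝒢 : AdelicGroupData.{0} K}
  {S : Type*} [Group S] [TopologicalSpace S] {ιinf : S →* 𝒢.Adelic} {γ : ℂ → S}

/-- **Uniform continuity of the probe differential along the probe family, across the compact quotient.**  Let `Φ` be
left-`A_G G(K)`-invariant with every probe differentiable at `0` and `y ↦ D_y z` continuous for each `z` (`D_y` the probe differential
at `y`), `ιinf`, `γ` continuous with `γ 0 = 1`, and the automorphic quotient compact.  Then `‖D_{x ιinf γ(w)} − D_x‖ → 0` as `w → 0`
UNIFORMLY in `x ∈ G(𝔸_K)`: the continuous map `(x, w) ↦ D_{x ιinf γ(w)} − D_x` is left-invariant in `x`, so it descends to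
`(G(𝔸_K) ⧸ A_G G(K)) × ℂ` (open quotient map `mk × id`), vanishes on the compact slice `w = 0`, and the tube lemma applies.
[cite: Borel1997, §2.1 (4) and Thm. 2.13] -/
theorem exists_forall_norm_fderiv_sub_lt [CompactSpace 𝒢.automorphicQuotient] (hι : Continuous ιinf) (hγc : Continuous γ)
    (hγ0 : γ 0 = 1) {Φ : 𝒢.Adelic → ℂ} (hΦ : ∀ γr ∈ 𝒢.quotientSubgroup, ∀ g, Φ (γr * g) = Φ g)
    (hcontD : ∀ z : ℂ, Continuous fun y => fderiv ℝ (fun w : ℂ => Φ (y * ιinf (γ w))) 0 z) {ε : ℝ} (hε : 0 < ε) :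
    ∃ δ > 0, ∀ w : ℂ, ‖w‖ < δ → ∀ x : 𝒢.Adelic,
      ‖fderiv ℝ (fun w' : ℂ => Φ (x * ιinf (γ w) * ιinf (γ w'))) 0 - fderiv ℝ (fun w' : ℂ => Φ (x * ιinf (γ w'))) 0‖ < ε := by
  -- the differential `Df y = D_y` as a continuous `CLM`-valued map (finite-dimensional source), left-invariant in `y`
  obtain ⟨Df, hDf⟩ : ∃ Df : 𝒢.Adelic → ℂ →L[ℝ] ℂ, ∀ y, Df y = fderiv ℝ (fun w : ℂ => Φ (y * ιinf (γ w))) 0 :=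
    ⟨_, fun _ => rfl⟩
  have hDc : Continuous Df := by
    refine continuous_clm_apply.2 fun z => ?_
    simp only [hDf]
    exact hcontD z
  have hDinv : ∀ γr ∈ 𝒢.quotientSubgroup, ∀ y, Df (γr * y) = Df y := fun γr hγr y => by
    simp only [hDf, mul_assoc, hΦ γr hγr]
  -- the two-variable map `F (g, w) = D_{g⁻¹ ιinf γ(w)} − D_{g⁻¹}` (inverted so that it descends along `QuotientGroup.mk`)
  obtain ⟨F, hF⟩ : ∃ F : 𝒢.Adelic × ℂ → ℂ →L[ℝ] ℂ, ∀ p, F p = Df (p.1⁻¹ * ιinf (γ p.2)) - Df p.1⁻¹ :=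
    ⟨_, fun _ => rfl⟩
  have hFc : Continuous F := by
    have e : F = fun p : 𝒢.Adelic × ℂ => Df (p.1⁻¹ * ιinf (γ p.2)) - Df p.1⁻¹ := funext hF
    rw [e]
    exact (hDc.comp ((continuous_fst.inv).mul (hι.comp (hγc.comp continuous_snd)))).sub (hDc.comp continuous_fst.inv)
  have hFinv : ∀ γr ∈ 𝒢.quotientSubgroup, ∀ (g : 𝒢.Adelic) (w : ℂ), F (g * γr, w) = F (g, w) := by
    intro γr hγr g w
    rw [hF, hF, mul_inv_rev, mul_assoc, hDinv _ (inv_mem hγr), hDinv _ (inv_mem hγr)]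
  -- its descent `Gq` to `(G(𝔸_K) ⧸ A_G G(K)) × ℂ`, continuous because `mk × id` is an (open) quotient map
  obtain ⟨Gq, hGmk⟩ : ∃ Gq : 𝒢.automorphicQuotient × ℂ → ℂ →L[ℝ] ℂ,
      ∀ (g : 𝒢.Adelic) (w : ℂ), Gq (𝒢.toAutomorphicQuotient g, w) = F (g, w) := by
    refine ⟨fun p => F ((Quotient.out (p.1 : 𝒢.Adelic ⧸ 𝒢.quotientSubgroup) : 𝒢.Adelic), p.2), fun g w => ?_⟩
    obtain ⟨h, hh⟩ := QuotientGroup.mk_out_eq_mul 𝒢.quotientSubgroup g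
    have e : ((Quotient.out (𝒢.toAutomorphicQuotient g : 𝒢.Adelic ⧸ 𝒢.quotientSubgroup)) : 𝒢.Adelic) = g * h := hh
    show F (((Quotient.out (𝒢.toAutomorphicQuotient g : 𝒢.Adelic ⧸ 𝒢.quotientSubgroup)) : 𝒢.Adelic), w) = F (g, w)
    rw [e]
    exact hFinv _ h.2 g w
  have hq : IsQuotientMap (Prod.map 𝒢.toAutomorphicQuotient (id : ℂ → ℂ)) :=
    ((QuotientGroup.isOpenQuotientMap_mk (N := 𝒢.quotientSubgroup)).prodMap IsOpenQuotientMap.id).isQuotientMap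
  have hGc : Continuous Gq := by
    rw [hq.continuous_iff]
    have e : Gq ∘ Prod.map 𝒢.toAutomorphicQuotient (id : ℂ → ℂ) = F := by
      funext ⟨g, w⟩
      exact hGmk g w
    rw [e]
    exact hFc
  -- tube lemma over the compact quotient at the slice `w = 0`
  have hG0 : ∀ q : 𝒢.automorphicQuotient, Gq (q, 0) = 0 := by
    intro q
    obtain ⟨g, rfl⟩ := toAutomorphicQuotient_surjective q
    rw [hGmk, hF, hγ0, map_one, mul_one, sub_self]
  have hP : ∀ q ∈ (univ : Set 𝒢.automorphicQuotient), ∀ᶠ p : ℂ × 𝒢.automorphicQuotient in 𝓝 ((0 : ℂ), q),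
      ‖Gq (p.2, p.1)‖ < ε := by
    intro q _
    have hc : Continuous fun p : ℂ × 𝒢.automorphicQuotient => ‖Gq (p.2, p.1)‖ :=
      continuous_norm.comp (hGc.comp continuous_swap)
    have h0 : ‖Gq (q, 0)‖ < ε := by rw [hG0, norm_zero]; exact hε
    have ht : Tendsto (fun p : ℂ × 𝒢.automorphicQuotient => ‖Gq (p.2, p.1)‖) (𝓝 ((0 : ℂ), q)) (𝓝 ‖Gq (q, 0)‖) :=
      hc.tendsto ((0 : ℂ), q)
    exact ht.eventually_lt_const h0
  have hev := (isCompact_univ (X := 𝒢.automorphicQuotient)).eventually_forall_of_forall_eventually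
    (x₀ := (0 : ℂ)) (P := fun w q => ‖Gq (q, w)‖ < ε) hP
  obtain ⟨δ, hδ, hball⟩ := Metric.eventually_nhds_iff.1 hev
  refine ⟨δ, hδ, fun w hw x => ?_⟩
  have hwx : ‖Gq (𝒢.toAutomorphicQuotient x⁻¹, w)‖ < ε :=
    hball (by rwa [dist_zero_right]) (𝒢.toAutomorphicQuotient x⁻¹) (mem_univ _)
  rw [hGmk, hF, inv_inv, hDf, hDf] at hwx
  exact hwx

end Uniform

/-! ## §3 The `𝔭`-orbit map of the `L²` class of a regular function: Fréchet derivative at `0` and weak Cauchy–Riemann -/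

section Orbit

variable {K : Type} [Field K] [NumberField K] {𝒢 : AdelicGroupData.{0} K} {μ : Measure 𝒢.automorphicQuotient}
  {S : Type*} [Group S] [TopologicalSpace S] {ιinf : S →* 𝒢.Adelic} {γ : ℂ → S}

/-- **The orbit map `z ↦ R(ιinf γ(z))[Φ]` is Fréchet differentiable at `0`, with derivative the class of the probe differential.**
For `Φ` continuous and left-`A_G G(K)`-invariant on `G(𝔸_K)` with COMPACT automorphic quotient, whose probes `w ↦ Φ(y ιinf γ(w))` are
differentiable at `0` with `y ↦ D_y z` continuous, along a continuous probe family `γ` with the RAY LAW `γ((s+t)z) = γ(sz) γ(tz)`: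
there is `D : ℂ →L[ℝ] L²(μ)` with `HasFDerivAt (z ↦ R(ιinf γ z)[Φ]) D 0` and `D z = [y ↦ D_y z]`.  PROOF (first order only): the
remainder `[Φ(· ιinf γ z)] − [Φ] − D z` is the class of `x ↦ Φ(x ιinf γ z) − Φ(x) − D_x z`, which is `≤ ε‖z‖` UNIFORMLY in `x` for
`‖z‖` small (§1 mean value along the ray + §2 uniform smallness), hence of `L²`-norm `≤ μ(X)^{1/2} ε ‖z‖` (Mathlib `Lp.norm_le_of_ae_bound`).
[cite: Borel1997, §2.1 (4), Thm. 2.13 and §5.14] [cite: BorelJacquet1979, §4.6] -/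
theorem exists_hasFDerivAt_rightRegular_toLp [𝒢.IsAutomorphicMeasure μ] [CompactSpace 𝒢.automorphicQuotient]
    (hι : Continuous ιinf) (hγc : Continuous γ) (hγ0 : γ 0 = 1)
    (hγadd : ∀ (s t : ℝ) (z : ℂ), γ (((s + t : ℝ) : ℂ) * z) = γ (((s : ℝ) : ℂ) * z) * γ (((t : ℝ) : ℂ) * z))
    {Φ : 𝒢.Adelic → ℂ} (hΦ : ∀ γr ∈ 𝒢.quotientSubgroup, ∀ g, Φ (γr * g) = Φ g) (hc : Continuous Φ)
    (hdiff : ∀ y, DifferentiableAt ℝ (fun w : ℂ => Φ (y * ιinf (γ w))) 0)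
    (hcontD : ∀ z : ℂ, Continuous fun y => fderiv ℝ (fun w : ℂ => Φ (y * ιinf (γ w))) 0 z)
    (hmem : MemLp (toQuotFun 𝒢 Φ) 2 μ) :
    ∃ D : ℂ →L[ℝ] 𝒢.L2 μ,
      HasFDerivAt (fun z : ℂ => 𝒢.rightRegular μ (ιinf (γ z)) (hmem.toLp (toQuotFun 𝒢 Φ))) D 0 ∧
      ∀ z : ℂ, (D z : 𝒢.automorphicQuotient → ℂ) =ᵐ[μ]
        toQuotFun 𝒢 fun y => fderiv ℝ (fun w : ℂ => Φ (y * ιinf (γ w))) 0 z := by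
  -- the derivative functions `ψ_z : y ↦ D_y z` and the classes of `ψ_1`, `ψ_I`
  have hleftD : ∀ z : ℂ, ∀ γr ∈ 𝒢.quotientSubgroup, ∀ g,
      (fun y => fderiv ℝ (fun w : ℂ => Φ (y * ιinf (γ w))) 0 z) (γr * g) =
        (fun y => fderiv ℝ (fun w : ℂ => Φ (y * ιinf (γ w))) 0 z) g := fun z γr hγr g => by
    simp only [mul_assoc, hΦ γr hγr]
  have hmemD : ∀ z : ℂ, MemLp (toQuotFun 𝒢 fun y => fderiv ℝ (fun w : ℂ => Φ (y * ιinf (γ w))) 0 z) 2 μ := fun z =>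
    memLp_toQuotFun (hleftD z) (hcontD z) 2
  set v₁ : 𝒢.L2 μ := (hmemD 1).toLp (toQuotFun 𝒢 fun y => fderiv ℝ (fun w : ℂ => Φ (y * ιinf (γ w))) 0 1) with hv₁
  set v₂ : 𝒢.L2 μ := (hmemD Complex.I).toLp (toQuotFun 𝒢 fun y => fderiv ℝ (fun w : ℂ => Φ (y * ιinf (γ w))) 0 Complex.I)
    with hv₂
  -- the candidate derivative `D z = Re z • [ψ_1] + Im z • [ψ_I]`
  set D : ℂ →L[ℝ] 𝒢.L2 μ :=
    ((ContinuousLinearMap.toSpanSingleton ℂ v₁).restrictScalars ℝ).comp (Complex.ofRealCLM.comp Complex.reCLM) +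
      ((ContinuousLinearMap.toSpanSingleton ℂ v₂).restrictScalars ℝ).comp (Complex.ofRealCLM.comp Complex.imCLM) with hDdef
  have hDapp : ∀ z : ℂ, D z = ((z.re : ℝ) : ℂ) • v₁ + ((z.im : ℝ) : ℂ) • v₂ := fun z => rfl
  have hψ : ∀ (z : ℂ) (y : 𝒢.Adelic), fderiv ℝ (fun w : ℂ => Φ (y * ιinf (γ w))) 0 z =
      ((z.re : ℝ) : ℂ) * fderiv ℝ (fun w : ℂ => Φ (y * ιinf (γ w))) 0 1 +
        ((z.im : ℝ) : ℂ) * fderiv ℝ (fun w : ℂ => Φ (y * ιinf (γ w))) 0 Complex.I := by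
    intro z y
    have ez : z = (z.re : ℝ) • (1 : ℂ) + (z.im : ℝ) • Complex.I := by
      rw [Complex.real_smul, Complex.real_smul, mul_one, Complex.re_add_im]
    conv_lhs => rw [ez]
    rw [map_add, map_smul, map_smul, Complex.real_smul, Complex.real_smul]
  have hD' : ∀ z : ℂ, (D z : 𝒢.automorphicQuotient → ℂ) =ᵐ[μ]
      toQuotFun 𝒢 fun y => fderiv ℝ (fun w : ℂ => Φ (y * ιinf (γ w))) 0 z := by
    intro z
    rw [hDapp z]
    filter_upwards [Lp.coeFn_add ((((z.re : ℝ) : ℂ)) • v₁) ((((z.im : ℝ) : ℂ)) • v₂), Lp.coeFn_smul (((z.re : ℝ) : ℂ)) v₁,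
      Lp.coeFn_smul (((z.im : ℝ) : ℂ)) v₂, (hmemD 1).coeFn_toLp, (hmemD Complex.I).coeFn_toLp] with y h1 h2 h3 h4 h5
    rw [h1, Pi.add_apply, h2, h3, Pi.smul_apply, Pi.smul_apply, h4, h5, smul_eq_mul, smul_eq_mul]
    simp only [toQuotFun]
    rw [hψ z]
  -- the orbit map `B` and the representatives of `B z`
  set B : ℂ → 𝒢.L2 μ := fun z => 𝒢.rightRegular μ (ιinf (γ z)) (hmem.toLp (toQuotFun 𝒢 Φ)) with hB
  have hmemT : ∀ a : 𝒢.Adelic, MemLp (toQuotFun 𝒢 fun x => Φ (x * a)) 2 μ := fun a =>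
    memLp_toQuotFun (leftInvariant_mul_right hΦ a) (hc.comp (continuous_id.mul continuous_const)) 2
  have hB' : ∀ z : ℂ, (B z : 𝒢.automorphicQuotient → ℂ) =ᵐ[μ] toQuotFun 𝒢 fun x => Φ (x * ιinf (γ z)) := fun z => by
    have e : B z = (hmemT (ιinf (γ z))).toLp (toQuotFun 𝒢 fun x => Φ (x * ιinf (γ z))) :=
      (toLp_toQuotFun_mul_right hΦ _ hmem (hmemT _)).symm
    rw [e]
    exact (hmemT _).coeFn_toLp
  -- the `L²` estimate of the remainder: `‖B z − B 0 − D z‖ ≤ c ‖z‖` for `‖z‖` small, every `c > 0`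
  have key : ∀ c : ℝ, 0 < c → ∀ᶠ z in 𝓝 (0 : ℂ), ‖B z - B 0 - D z‖ ≤ c * ‖z‖ := by
    intro c hc0
    set Cμ : ℝ := (measureUnivNNReal μ : ℝ) ^ (2 : ℝ≥0∞).toReal⁻¹ with hCμ
    have hCμ0 : 0 ≤ Cμ := by positivity
    obtain ⟨δ, hδ, hδε⟩ := exists_forall_norm_fderiv_sub_lt hι hγc hγ0 hΦ hcontD (ε := c / (Cμ + 1)) (by positivity)
    rw [Metric.eventually_nhds_iff]
    refine ⟨δ, hδ, fun z hz => ?_⟩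
    rw [dist_zero_right] at hz
    -- the pointwise first-order bound, uniform in `x`
    have hpt : ∀ x : 𝒢.Adelic,
        ‖Φ (x * ιinf (γ z)) - Φ x - fderiv ℝ (fun w : ℂ => Φ (x * ιinf (γ w))) 0 z‖ ≤ c / (Cμ + 1) * ‖z‖ := by
      intro x
      refine norm_sub_sub_le_of_ray ιinf γ hγadd hdiff hγ0 x z fun s hs => (hδε (((s : ℝ) : ℂ) * z) ?_ x).le
      calc ‖((s : ℝ) : ℂ) * z‖ = |s| * ‖z‖ := by rw [norm_mul, Complex.norm_real, Real.norm_eq_abs]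
        _ ≤ 1 * ‖z‖ := by
          refine mul_le_mul_of_nonneg_right ?_ (norm_nonneg _)
          exact abs_le.2 ⟨by linarith [hs.1], hs.2⟩
        _ < δ := by rw [one_mul]; exact hz
    have hK : ‖B z - B 0 - D z‖ ≤ Cμ * (c / (Cμ + 1) * ‖z‖) := by
      refine Lp.norm_le_of_ae_bound (by positivity) ?_
      filter_upwards [Lp.coeFn_sub (B z - B 0) (D z), Lp.coeFn_sub (B z) (B 0), hB' z, hB' 0, hD' z]
        with y h1 h2 h3 h4 h5
      rw [h1, Pi.sub_apply, h2, Pi.sub_apply, h3, h4, h5]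
      simp only [toQuotFun]
      rw [hγ0, map_one, mul_one]
      exact hpt _
    calc ‖B z - B 0 - D z‖ ≤ Cμ * (c / (Cμ + 1) * ‖z‖) := hK
      _ = Cμ / (Cμ + 1) * (c * ‖z‖) := by ring
      _ ≤ 1 * (c * ‖z‖) := by
          refine mul_le_mul_of_nonneg_right ((div_le_one (by positivity)).2 (by linarith)) (by positivity)
      _ = c * ‖z‖ := one_mul _
  have hFD : HasFDerivAt B D 0 := by
    rw [hasFDerivAt_iff_isLittleO_nhds_zero]
    refine Asymptotics.isLittleO_iff.2 fun c hc0 => ?_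
    filter_upwards [key c hc0] with z hz
    rw [zero_add]
    exact hz
  exact ⟨D, hFD, hD'⟩

/-- **`diffOrbit` and `weakHol` of the class of a regular function.**  Under the hypotheses of
`exists_hasFDerivAt_rightRegular_toLp` and POINTWISE Cauchy–Riemann of the probes (`D_y (i z) = i D_y z`), the orbit map
`z ↦ R(ιinf γ(z))[Φ]` is differentiable at `0` and its differential is `ℂ`-linear (weak Cauchy–Riemann): the differential is the class
of `y ↦ D_y z`, and the two classes `[y ↦ D_y (iz)]`, `i • [y ↦ D_y z]` have equal representatives. [cite: Borel1997, §5.14]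
[cite: BorelWallach2000, VII 2.10] -/
theorem differentiableAt_rightRegular_toLp_of_probeCR [𝒢.IsAutomorphicMeasure μ] [CompactSpace 𝒢.automorphicQuotient]
    (hι : Continuous ιinf) (hγc : Continuous γ) (hγ0 : γ 0 = 1)
    (hγadd : ∀ (s t : ℝ) (z : ℂ), γ (((s + t : ℝ) : ℂ) * z) = γ (((s : ℝ) : ℂ) * z) * γ (((t : ℝ) : ℂ) * z))
    {Φ : 𝒢.Adelic → ℂ} (hΦ : ∀ γr ∈ 𝒢.quotientSubgroup, ∀ g, Φ (γr * g) = Φ g) (hc : Continuous Φ)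
    (hdiff : ∀ y, DifferentiableAt ℝ (fun w : ℂ => Φ (y * ιinf (γ w))) 0)
    (hcontD : ∀ z : ℂ, Continuous fun y => fderiv ℝ (fun w : ℂ => Φ (y * ιinf (γ w))) 0 z)
    (hCR : ∀ (y : 𝒢.Adelic) (z : ℂ), fderiv ℝ (fun w : ℂ => Φ (y * ιinf (γ w))) 0 (Complex.I • z) =
      Complex.I • fderiv ℝ (fun w : ℂ => Φ (y * ιinf (γ w))) 0 z)
    (hmem : MemLp (toQuotFun 𝒢 Φ) 2 μ) :
    DifferentiableAt ℝ (fun z : ℂ => 𝒢.rightRegular μ (ιinf (γ z)) (hmem.toLp (toQuotFun 𝒢 Φ))) 0 ∧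
      ∀ z : ℂ, fderiv ℝ (fun z : ℂ => 𝒢.rightRegular μ (ιinf (γ z)) (hmem.toLp (toQuotFun 𝒢 Φ))) 0 (Complex.I • z) =
        Complex.I • fderiv ℝ (fun z : ℂ => 𝒢.rightRegular μ (ιinf (γ z)) (hmem.toLp (toQuotFun 𝒢 Φ))) 0 z := by
  obtain ⟨D, hD, hDae⟩ := exists_hasFDerivAt_rightRegular_toLp hι hγc hγ0 hγadd hΦ hc hdiff hcontD hmem
  refine ⟨hD.differentiableAt, fun z => ?_⟩
  rw [hD.fderiv]
  apply Lp.ext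
  filter_upwards [hDae (Complex.I • z), hDae z, Lp.coeFn_smul Complex.I (D z)] with y h1 h2 h3
  rw [h1, h3, Pi.smul_apply, h2]
  simp only [toQuotFun]
  rw [hCR]

end Orbit

/-! ## §4 Pointwise reproduction by a compactly supported continuous kernel ⇒ reproduction in `L²` -/

section Repro

variable {K : Type} [Field K] [NumberField K] {𝒢 : AdelicGroupData.{0} K} {μ : Measure 𝒢.automorphicQuotient}
  {U : Type*} [Group U] [TopologicalSpace U] [IsTopologicalGroup U] [MeasurableSpace U] [BorelSpace U]
  [SecondCountableTopology U] [LocallyCompactSpace U]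

/-- **Pointwise reproduction ⇒ `L²` reproduction** (scalar twin of ★ `F0P2dStubSOrbitMap.sum_integral_smul_rightRegular_toLp_eq_self`).
If the continuous compactly supported kernel `A` on `U` reproduces the continuous left-invariant `Φ` along the continuous `ιA` —
`∫ A(u) Φ(y ιA u) dν(u) = Φ(y)` for ALL `y` — then `∫ A(u) • R(ιA u)[Φ] dν(u) = [Φ]` in `L²(μ)`: the Bochner integral has the orbital
integral as representative (★ p796993 `coeFn_integral_smul_rightRegular_toLp_eq_orbitalIntegral`, Fubini), which is `Φ` pointwise.
[cite: BorelJacquet1979, §4.6] [cite: Borel1997, §2.13] -/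
theorem integral_smul_rightRegular_toLp_eq_self [𝒢.IsAutomorphicMeasure μ] (ν : Measure U) [ν.IsHaarMeasure]
    {ιA : U →* 𝒢.Adelic} (hι : Continuous ιA) {A : U → ℂ} (hAc : Continuous A) (hAs : HasCompactSupport A)
    {Φ : 𝒢.Adelic → ℂ} (hΦ : ∀ γr ∈ 𝒢.quotientSubgroup, ∀ g, Φ (γr * g) = Φ g)
    (hmem : MemLp (toQuotFun 𝒢 Φ) 2 μ) (hrep : ∀ y, ∫ u, A u * Φ (y * ιA u) ∂ν = Φ y) :
    (∫ u, A u • 𝒢.rightRegular μ (ιA u) (hmem.toLp (toQuotFun 𝒢 Φ)) ∂ν) = hmem.toLp (toQuotFun 𝒢 Φ) := by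
  apply Lp.ext
  filter_upwards [𝒢.coeFn_integral_smul_rightRegular_toLp_eq_orbitalIntegral μ ν hι hAc hAs hmem, hmem.coeFn_toLp]
    with y hy hΦy
  obtain ⟨g, hg⟩ := toAutomorphicQuotient_surjective y
  rw [hy g hg, hΦy, ← hg, toQuotFun_mk hΦ g]
  have e : ∀ u, invQuot 𝒢 (toQuotFun 𝒢 Φ) (g⁻¹ * ιA u) = Φ (g⁻¹ * ιA u) := fun u => by
    rw [invQuot_apply, ← apply_eq_toQuotFun hΦ]
  simp only [e]
  exact hrep g⁻¹

end Repro

/-! ## §5 `L²` dictionary: pointwise right invariance ∕ scalar type relation ⇒ the same for the class -/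

section Dictionary

variable {K : Type} [Field K] [NumberField K] {𝒢 : AdelicGroupData.{0} K} {μ : Measure 𝒢.automorphicQuotient}

/-- **Pointwise scalar type relation ⇒ `L²` type relation**: if `Φ(x a) = c · Φ(x)` for all `x` then `R(a)[Φ] = c • [Φ]`
(dictionary `R(a)[Φ] = [Φ(· a)]`, ★ `SpectrumJunction.toLp_toQuotFun_mul_right`). [cite: BorelJacquet1979, §4.2 and §4.6] -/
theorem rightRegular_toLp_toQuotFun_eq_smul [SMulInvariantMeasure 𝒢.Adelic 𝒢.automorphicQuotient μ]
    {Φ : 𝒢.Adelic → ℂ} (hΦ : ∀ γr ∈ 𝒢.quotientSubgroup, ∀ g, Φ (γr * g) = Φ g)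
    (hmem : MemLp (toQuotFun 𝒢 Φ) 2 μ) {a : 𝒢.Adelic} (c : ℂ) (h : ∀ x, Φ (x * a) = c * Φ x) :
    𝒢.rightRegular μ a (hmem.toLp (toQuotFun 𝒢 Φ)) = c • hmem.toLp (toQuotFun 𝒢 Φ) := by
  have e : (fun x => Φ (x * a)) = c • Φ := funext fun x => by rw [h x, Pi.smul_apply, smul_eq_mul]
  have hmem' : MemLp (toQuotFun 𝒢 fun x => Φ (x * a)) 2 μ := by
    rw [e, toQuotFun_smul]
    exact hmem.const_smul c
  rw [← toLp_toQuotFun_mul_right hΦ a hmem hmem', ← MemLp.toLp_const_smul]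
  exact MemLp.toLp_congr hmem' (hmem.const_smul c) (Filter.EventuallyEq.of_eq (by rw [e, toQuotFun_smul]))

/-- **Pointwise right invariance ⇒ `L²` invariance**: if `Φ(x a) = Φ(x)` for all `x` then `R(a)[Φ] = [Φ]` (the case `c = 1`; scalar
twin of ★ `F0P2dStubSCotFormL2Data.rightRegular_toLp_toQuotFun_eq_self`). [cite: BorelJacquet1979, §4.2 and §4.6] -/
theorem rightRegular_toLp_toQuotFun_eq_self' [SMulInvariantMeasure 𝒢.Adelic 𝒢.automorphicQuotient μ]
    {Φ : 𝒢.Adelic → ℂ} (hΦ : ∀ γr ∈ 𝒢.quotientSubgroup, ∀ g, Φ (γr * g) = Φ g)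
    (hmem : MemLp (toQuotFun 𝒢 Φ) 2 μ) {a : 𝒢.Adelic} (h : ∀ x, Φ (x * a) = Φ x) :
    𝒢.rightRegular μ a (hmem.toLp (toQuotFun 𝒢 Φ)) = hmem.toLp (toQuotFun 𝒢 Φ) := by
  rw [rightRegular_toLp_toQuotFun_eq_smul hΦ hmem 1 fun x => by rw [h x, one_mul], one_smul]

end Dictionary

end Summit.HodgeConjecture.HodgeConjecture.Cruxes.HLiu418.F0P5TP2StubS2OrbitMap

end
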